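import Mathlib
import HarnessLib
import Summits.HubbardSuperconductivity.HubbardSuperconductivity.Theorems.KLProgrammeKLRegimeEngineTwoLegCutLegDualData
import Summits.HubbardSuperconductivity.HubbardSuperconductivity.Theorems.KLProgrammeKLRegimeEngineV8TwoLegMomentsExportGrid

/-!
# Row C1 (`hcut`, the cutoff leg) of stub (e) at every scale, (R) KEYED TO THE GRID ATOM of token #23
# (cell gate-hubbard-kl, seat hubbard-kl-r2d-p1 g8; GRID twin of k3c5-p2's `…EngineTwoLegCutLegDualData`, p558504, itself the M-leg twin on this
# lineage's `…EngineTwoLegCutLegStepSplit`, p549509)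

WHY.  Plan g19 (R59o) made the GRID two-leg moments atom `TwoLegGridMomentsAt` (`…EngineV8TwoLegMomentsExportGrid`, p557865) THE text of record of the
(b) → (e) two-leg export; the dual-lattice atom is retired (F-GRID: the trivial-multiplier dual kernel of the cumulative one-shot action carries the
`2M`-frequency Dirichlet tail at every scale).  k3c5-p2's row-C1 packagings read their (R) half — the separated shell-tube gradient of the FIRST cutoff's
reading `(L₁, M₁)` at scale `n` — from a dual moment `Ms n`; here (R) is read from the grid atom of `(L₁, M₁)` at its own flow frame
(`twoLeg_slopeSizes_of_twoLegGridMomentsAt`: `‖∇ I_{L₁}[Re Σ − K∘p]‖ ≤ Zs·U²` at every `q`, n-free budgets).  The (D) half (the two-cutoff dual ROW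
DIFFERENCE at `±ω₀`, phase-weighted time sums = the `±ω₀` frequency slices, representation-free) and the budget algebra are VERBATIM k3c5-p2's:

* **`cutLeg_allScales_of_gridMoments_V17F2_rates`** — private rates `a n ≤ Q.CL β n/4`, budget `(Zs·U² + 4/3·Gfr₁U²)·F_n/klCurveD + (F_n + Dc n) ≤ a n`;
* **`cutLeg_allScales_of_gridMoments_V17F2_geometric4`** — the maximal geometric rates `d·4^n` with the bookkeeping discharged (`Dc n ≤ d·4^n/3`,
  smallness `Zs·U² + 4/3·Gfr₁U² ≤ klCurveD`).

Proofs only (k3c5-p2's proofs with the (R) line swapped); no definitions; nothing about the model is asserted; nothing asserts superconductivity.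
References: BGM 2006 §2.4 (2.23), (2.36) [cite: BenfattoGiulianiMastropietro2006].
-/

noncomputable section

namespace Summit.HubbardSuperconductivity.HubbardSuperconductivity.Theorems.EngineV8

set_option linter.dupNamespace false -- summit = problem name (single-conjunct summit), D-0017

open Real Finset Complex Literature.MathematicalPhysics.QuantumLattice Literature.Probability.LatticeModels GrassmannAlgebra
open Summit.HubbardSuperconductivity.HubbardSuperconductivity.Theorems.KLProgrammeLegKernels
open Summit.HubbardSuperconductivity.HubbardSuperconductivity.Theorems.DispersionFlow
open Summit.HubbardSuperconductivity.HubbardSuperconductivity.Theorems.PerturbedFermiCurve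
open Summit.HubbardSuperconductivity.HubbardSuperconductivity.Theorems.KLRegimeSplit
open Summit.HubbardSuperconductivity.HubbardSuperconductivity.Theorems.TwoPointAssembly
open Summit.HubbardSuperconductivity.HubbardSuperconductivity.Theorems.TwoVolumeDefect
open Summit.HubbardSuperconductivity.HubbardSuperconductivity.Theorems.TwoLegFourier

section V17F2

variable {L : ℕ} {G : GeoConsts} {P : SplitConsts} {Q : EngConsts} {R : RenConsts} {β U μ c : ℝ}

/-- **ROW C1 (`hcut`) AT EVERY SCALE, (R) KEYED TO THE GRID ATOM, private rates**: as k3c5-p2's `cutLeg_allScales_of_dualData_V17F2_rates`, with (R)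
supplied by the GRID atom `TwoLegGridMomentsAt L₁ M₁ Zt Zs β U μ (K_n(L₁,M₁)) n` of the FIRST cutoff's one-shot grid action (token #23's text of record;
GLOBAL separated gradient `Zs·U²` by `twoLeg_slopeSizes_of_twoLegGridMomentsAt`, n-free budgets); budget `(Zs·U² + 4/3·Gfr₁U²)·F_n/klCurveD + (F_n + Dc n) ≤ a n`. -/
theorem cutLeg_allScales_of_gridMoments_V17F2_rates (hR : ∀ j, 0 ≤ R.Gfr j) (hc : 0 < c) (hcle : c ≤ klCurveC3 R) (hU : 0 < U)
    (hUle : U ≤ klCurveU0 R) (hβmin : klBetaMin ≤ β) (hβc : β ≤ Real.exp (c / U ^ 2)) (hμ : μ ∈ klWindowC) (hL : klEngL₃ β U ≤ L)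
    (h0 : FrameOK R U (nScales β) μ 0) {N : ℕ} (hN : N ≤ nScales β + 1) {a Dc : ℕ → ℝ} {Zt Zs : ℝ} (ha : ∀ n ≤ N, a n ≤ Q.CL β n / 4)
    (hZs0 : 0 ≤ Zs)
    (hGs : ∀ n ≤ N, ∀ (Mq : ℕ → ℕ) (L₁ M₁ M₂ : ℕ) [NeZero L₁] [NeZero M₁] [NeZero M₂], L ≤ L₁ → Q.M0 β L₁ ≤ M₁ → Mq L₁ ≤ M₁ →
      M₁ ≤ M₂ →
      (∀ j < n, histV17F2 L₁ M₁ G P Q R β U μ j ∧ TwoLegSlopes L₁ M₁ R β U μ (klFlowFrameU L₁ M₁ β U μ j) j) →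
      (∀ j < n, histV17F2 L₁ M₂ G P Q R β U μ j ∧ TwoLegSlopes L₁ M₂ R β U μ (klFlowFrameU L₁ M₂ β U μ j) j) →
      (∀ m < n, ∀ θ : ℝ, |klLocalPart L₁ M₁ β U μ (klFlowFrameU L₁ M₁ β U μ m) m θ -
        klLocalPart L₁ M₂ β U μ (klFlowFrameU L₁ M₂ β U μ m) m θ| ≤ a m / L₁) →
      (∀ q : Fin 2 → ℝ, |(klFlowFrameU L₁ M₁ β U μ n).eval q - (klFlowFrameU L₁ M₂ β U μ n).eval q| ≤ (∑ m ∈ range n, a m) / L₁) →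
        TwoLegGridMomentsAt L₁ M₁ Zt Zs β U μ (klFlowFrameU L₁ M₁ β U μ n) n)
    (hdual : ∀ n ≤ N, ∀ (Mq : ℕ → ℕ) (L₁ M₁ M₂ : ℕ) [NeZero L₁] [NeZero M₁] [NeZero M₂], L ≤ L₁ → Q.M0 β L₁ ≤ M₁ → Mq L₁ ≤ M₁ →
      M₁ ≤ M₂ →
      (∀ j < n, histV17F2 L₁ M₁ G P Q R β U μ j ∧ TwoLegSlopes L₁ M₁ R β U μ (klFlowFrameU L₁ M₁ β U μ j) j) →
      (∀ j < n, histV17F2 L₁ M₂ G P Q R β U μ j ∧ TwoLegSlopes L₁ M₂ R β U μ (klFlowFrameU L₁ M₂ β U μ j) j) →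
      (∀ m < n, ∀ θ : ℝ, |klLocalPart L₁ M₁ β U μ (klFlowFrameU L₁ M₁ β U μ m) m θ -
        klLocalPart L₁ M₂ β U μ (klFlowFrameU L₁ M₂ β U μ m) m θ| ≤ a m / L₁) →
      (∀ q : Fin 2 → ℝ, |(klFlowFrameU L₁ M₁ β U μ n).eval q - (klFlowFrameU L₁ M₂ β U μ n).eval q| ≤ (∑ m ∈ range n, a m) / L₁) →
      ∃ (o₁ : SpaceTimeIdx L₁ M₁) (o₂ : SpaceTimeIdx L₁ M₂),
        (∀ σ : Fin 2, ∑ y : TorusSite 2 L₁,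
          (‖(imagTimeWeight β M₁ : ℂ) * (∑ t₁ : ImagTimeIdx M₁,
              sectorisedKernel L₁ M₁ β (trivialMultiplier L₁ M₁)
                  (klEffectiveAction L₁ M₁ β U μ (klFlowFrameU L₁ M₁ β U μ n) klE0 n - counterQuadratic L₁ M₁ β (klFlowFrameU L₁ M₁ β U μ n)) 2
                  (![((0, σ), 0), ((0, σ), 1)] : Fin 2 → SectorLeg 1) ![o₁, (t₁, o₁.2 + y)] *
                Complex.exp (((matsubaraFreq β M₁ (omega0 M₁) * (imagTime β M₁ o₁.1 - imagTime β M₁ t₁) : ℝ) : ℂ) * I)) -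
            (imagTimeWeight β M₂ : ℂ) * (∑ t₁ : ImagTimeIdx M₂,
              sectorisedKernel L₁ M₂ β (trivialMultiplier L₁ M₂)
                  (klEffectiveAction L₁ M₂ β U μ (klFlowFrameU L₁ M₂ β U μ n) klE0 n - counterQuadratic L₁ M₂ β (klFlowFrameU L₁ M₂ β U μ n)) 2
                  (![((0, σ), 0), ((0, σ), 1)] : Fin 2 → SectorLeg 1) ![o₂, (t₁, o₂.2 + y)] *
                Complex.exp (((matsubaraFreq β M₂ (omega0 M₂) * (imagTime β M₂ o₂.1 - imagTime β M₂ t₁) : ℝ) : ℂ) * I))‖ +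
          ‖(imagTimeWeight β M₁ : ℂ) * (∑ t₁ : ImagTimeIdx M₁,
              sectorisedKernel L₁ M₁ β (trivialMultiplier L₁ M₁)
                  (klEffectiveAction L₁ M₁ β U μ (klFlowFrameU L₁ M₁ β U μ n) klE0 n - counterQuadratic L₁ M₁ β (klFlowFrameU L₁ M₁ β U μ n)) 2
                  (![((0, σ), 0), ((0, σ), 1)] : Fin 2 → SectorLeg 1) ![o₁, (t₁, o₁.2 + -y)] *
                Complex.exp (((matsubaraFreq β M₁ (omega0 M₁) * (imagTime β M₁ o₁.1 - imagTime β M₁ t₁) : ℝ) : ℂ) * I)) -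
            (imagTimeWeight β M₂ : ℂ) * (∑ t₁ : ImagTimeIdx M₂,
              sectorisedKernel L₁ M₂ β (trivialMultiplier L₁ M₂)
                  (klEffectiveAction L₁ M₂ β U μ (klFlowFrameU L₁ M₂ β U μ n) klE0 n - counterQuadratic L₁ M₂ β (klFlowFrameU L₁ M₂ β U μ n)) 2
                  (![((0, σ), 0), ((0, σ), 1)] : Fin 2 → SectorLeg 1) ![o₂, (t₁, o₂.2 + -y)] *
                Complex.exp (((matsubaraFreq β M₂ (omega0 M₂) * (imagTime β M₂ o₂.1 - imagTime β M₂ t₁) : ℝ) : ℂ) * I))‖) ≤ Dc n / L₁) ∧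
        (∀ σ : Fin 2, ∑ y : TorusSite 2 L₁,
          (‖(imagTimeWeight β M₁ : ℂ) * (∑ t₁ : ImagTimeIdx M₁,
              sectorisedKernel L₁ M₁ β (trivialMultiplier L₁ M₁)
                  (klEffectiveAction L₁ M₁ β U μ (klFlowFrameU L₁ M₁ β U μ n) klE0 n - counterQuadratic L₁ M₁ β (klFlowFrameU L₁ M₁ β U μ n)) 2
                  (![((0, σ), 0), ((0, σ), 1)] : Fin 2 → SectorLeg 1) ![o₁, (t₁, o₁.2 + y)] *
                Complex.exp (((matsubaraFreq β M₁ (omega0 M₁).rev * (imagTime β M₁ o₁.1 - imagTime β M₁ t₁) : ℝ) : ℂ) * I)) -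
            (imagTimeWeight β M₂ : ℂ) * (∑ t₁ : ImagTimeIdx M₂,
              sectorisedKernel L₁ M₂ β (trivialMultiplier L₁ M₂)
                  (klEffectiveAction L₁ M₂ β U μ (klFlowFrameU L₁ M₂ β U μ n) klE0 n - counterQuadratic L₁ M₂ β (klFlowFrameU L₁ M₂ β U μ n)) 2
                  (![((0, σ), 0), ((0, σ), 1)] : Fin 2 → SectorLeg 1) ![o₂, (t₁, o₂.2 + y)] *
                Complex.exp (((matsubaraFreq β M₂ (omega0 M₂).rev * (imagTime β M₂ o₂.1 - imagTime β M₂ t₁) : ℝ) : ℂ) * I))‖ +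
          ‖(imagTimeWeight β M₁ : ℂ) * (∑ t₁ : ImagTimeIdx M₁,
              sectorisedKernel L₁ M₁ β (trivialMultiplier L₁ M₁)
                  (klEffectiveAction L₁ M₁ β U μ (klFlowFrameU L₁ M₁ β U μ n) klE0 n - counterQuadratic L₁ M₁ β (klFlowFrameU L₁ M₁ β U μ n)) 2
                  (![((0, σ), 0), ((0, σ), 1)] : Fin 2 → SectorLeg 1) ![o₁, (t₁, o₁.2 + -y)] *
                Complex.exp (((matsubaraFreq β M₁ (omega0 M₁).rev * (imagTime β M₁ o₁.1 - imagTime β M₁ t₁) : ℝ) : ℂ) * I)) -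
            (imagTimeWeight β M₂ : ℂ) * (∑ t₁ : ImagTimeIdx M₂,
              sectorisedKernel L₁ M₂ β (trivialMultiplier L₁ M₂)
                  (klEffectiveAction L₁ M₂ β U μ (klFlowFrameU L₁ M₂ β U μ n) klE0 n - counterQuadratic L₁ M₂ β (klFlowFrameU L₁ M₂ β U μ n)) 2
                  (![((0, σ), 0), ((0, σ), 1)] : Fin 2 → SectorLeg 1) ![o₂, (t₁, o₂.2 + -y)] *
                Complex.exp (((matsubaraFreq β M₂ (omega0 M₂).rev * (imagTime β M₂ o₂.1 - imagTime β M₂ t₁) : ℝ) : ℂ) * I))‖) ≤ Dc n / L₁))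
    (hbudget : ∀ n ≤ N, (Zs * U ^ 2 + 4 / 3 * R.Gfr 1 * U ^ 2) * (∑ m ∈ range n, a m) / klCurveD + ((∑ m ∈ range n, a m) + Dc n) ≤ a n) :
    ∀ n ≤ N, ∀ (Mq : ℕ → ℕ) (L₁ M₁ M₂ : ℕ) [NeZero L₁] [NeZero M₁] [NeZero M₂], L ≤ L₁ → Q.M0 β L₁ ≤ M₁ → Mq L₁ ≤ M₁ → M₁ ≤ M₂ →
      (∀ j < n, histV17F2 L₁ M₁ G P Q R β U μ j ∧ TwoLegSlopes L₁ M₁ R β U μ (klFlowFrameU L₁ M₁ β U μ j) j) →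
      (∀ j < n, histV17F2 L₁ M₂ G P Q R β U μ j ∧ TwoLegSlopes L₁ M₂ R β U μ (klFlowFrameU L₁ M₂ β U μ j) j) →
        ∀ θ : ℝ, |klLocalPart L₁ M₁ β U μ (klFlowFrameU L₁ M₁ β U μ n) n θ -
          klLocalPart L₁ M₂ β U μ (klFlowFrameU L₁ M₂ β U μ n) n θ| ≤ Q.CL β n / 4 / L₁ := by
  have hβ0 : 0 < β := lt_of_lt_of_le (by norm_num [klBetaMin]) hβmin
  have h13 : 0 ≤ 4 / 3 * R.Gfr 1 * U ^ 2 := by have := hR 1; positivity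
  refine cutLeg_allScales_of_dualData_V17F2_rates (G := G) (P := P) (b := fun _ => Zs * U ^ 2 + 4 / 3 * R.Gfr 1 * U ^ 2)
    hR hc hcle hU hUle hβmin hβc hμ hL h0 hN ha (fun n hn => by have := hZs0; positivity) ?_ hdual hbudget
  intro n hn Mq L₁ M₁ M₂ _ _ _ hLL₁ hM₁ hMq hM₁₂ hh₁ hh₂ hrates hframe q _
  have hK₁ := frameOK_klFlowFrameU_of_histV17F2 (L' := L₁) (M' := M₁) hR h0 (hn.trans hN) hh₁
  have hdeg₁ : (klFlowFrameU L₁ M₁ β U μ n).degree ≤ L₁ / 2 :=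
    (frameOKDeg_klFlowFrameU hK₁ (hn.trans hN)).degree_le_half rfl hβmin (hL.trans hLL₁)
  have hsep := (twoLeg_slopeSizes_of_twoLegGridMomentsAt (L := L₁) (M := M₁) hβ0
    (hGs n hn Mq L₁ M₁ M₂ hLL₁ hM₁ hMq hM₁₂ hh₁ hh₂ hrates hframe)).2 q
  refine (norm_fderiv_evalM_symInterp_le_of_sep_at (L := L₁) (M := M₁) hdeg₁ β U μ n q hsep).trans ?_
  linarith [norm_iteratedFDeriv_one_frameShift_le_of_frameOK hR hK₁ q]

/-- **ROW C1 (`hcut`) AT EVERY SCALE ON THE MAXIMAL GEOMETRIC RATES `d·4^n`, (R) KEYED TO THE GRID ATOM — budget bookkeeping discharged**: with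
`0 ≤ d ≤ Q.CL β 0/4`, `Q.CL β 0·4^n ≤ Q.CL β n`, n-free grid budgets with `0 ≤ Zs` and `Zs·U² + 4/3·Gfr₁U² ≤ klCurveD`, per scale the grid atom of the first
cutoff and two-cutoff dual data with `Dc n ≤ d·4^n/3`: the literal `hcut` of the (e)/(M) closers at every `n ≤ N ≤ nScales β + 1`
(twin of k3c5-p2's `cutLeg_allScales_of_dualMoments_V17F2_geometric4` and of `spLeg_allScales_of_gridMoments_V17F2_geometric4`). -/
theorem cutLeg_allScales_of_gridMoments_V17F2_geometric4 (hR : ∀ j, 0 ≤ R.Gfr j) (hc : 0 < c) (hcle : c ≤ klCurveC3 R) (hU : 0 < U)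
    (hUle : U ≤ klCurveU0 R) (hβmin : klBetaMin ≤ β) (hβc : β ≤ Real.exp (c / U ^ 2)) (hμ : μ ∈ klWindowC) (hL : klEngL₃ β U ≤ L)
    (h0 : FrameOK R U (nScales β) μ 0) {N : ℕ} (hN : N ≤ nScales β + 1) {d : ℝ} (hd : 0 ≤ d) (hdCL : d ≤ Q.CL β 0 / 4)
    (hCL : ∀ n ≤ N, Q.CL β 0 * (4 : ℝ) ^ n ≤ Q.CL β n) {Dc : ℕ → ℝ} {Zt Zs : ℝ} (hZs0 : 0 ≤ Zs)
    (hsmall : Zs * U ^ 2 + 4 / 3 * R.Gfr 1 * U ^ 2 ≤ klCurveD) (hDc : ∀ n ≤ N, Dc n ≤ d * (4 : ℝ) ^ n / 3)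
    (hGs : ∀ n ≤ N, ∀ (Mq : ℕ → ℕ) (L₁ M₁ M₂ : ℕ) [NeZero L₁] [NeZero M₁] [NeZero M₂], L ≤ L₁ → Q.M0 β L₁ ≤ M₁ → Mq L₁ ≤ M₁ →
      M₁ ≤ M₂ →
      (∀ j < n, histV17F2 L₁ M₁ G P Q R β U μ j ∧ TwoLegSlopes L₁ M₁ R β U μ (klFlowFrameU L₁ M₁ β U μ j) j) →
      (∀ j < n, histV17F2 L₁ M₂ G P Q R β U μ j ∧ TwoLegSlopes L₁ M₂ R β U μ (klFlowFrameU L₁ M₂ β U μ j) j) →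
      (∀ m < n, ∀ θ : ℝ, |klLocalPart L₁ M₁ β U μ (klFlowFrameU L₁ M₁ β U μ m) m θ -
        klLocalPart L₁ M₂ β U μ (klFlowFrameU L₁ M₂ β U μ m) m θ| ≤ d * (4 : ℝ) ^ m / L₁) →
      (∀ q : Fin 2 → ℝ, |(klFlowFrameU L₁ M₁ β U μ n).eval q - (klFlowFrameU L₁ M₂ β U μ n).eval q| ≤
        (∑ m ∈ range n, d * (4 : ℝ) ^ m) / L₁) →
        TwoLegGridMomentsAt L₁ M₁ Zt Zs β U μ (klFlowFrameU L₁ M₁ β U μ n) n)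
    (hdual : ∀ n ≤ N, ∀ (Mq : ℕ → ℕ) (L₁ M₁ M₂ : ℕ) [NeZero L₁] [NeZero M₁] [NeZero M₂], L ≤ L₁ → Q.M0 β L₁ ≤ M₁ → Mq L₁ ≤ M₁ →
      M₁ ≤ M₂ →
      (∀ j < n, histV17F2 L₁ M₁ G P Q R β U μ j ∧ TwoLegSlopes L₁ M₁ R β U μ (klFlowFrameU L₁ M₁ β U μ j) j) →
      (∀ j < n, histV17F2 L₁ M₂ G P Q R β U μ j ∧ TwoLegSlopes L₁ M₂ R β U μ (klFlowFrameU L₁ M₂ β U μ j) j) →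
      (∀ m < n, ∀ θ : ℝ, |klLocalPart L₁ M₁ β U μ (klFlowFrameU L₁ M₁ β U μ m) m θ -
        klLocalPart L₁ M₂ β U μ (klFlowFrameU L₁ M₂ β U μ m) m θ| ≤ d * (4 : ℝ) ^ m / L₁) →
      (∀ q : Fin 2 → ℝ, |(klFlowFrameU L₁ M₁ β U μ n).eval q - (klFlowFrameU L₁ M₂ β U μ n).eval q| ≤
        (∑ m ∈ range n, d * (4 : ℝ) ^ m) / L₁) →
      ∃ (o₁ : SpaceTimeIdx L₁ M₁) (o₂ : SpaceTimeIdx L₁ M₂),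
        (∀ σ : Fin 2, ∑ y : TorusSite 2 L₁,
          (‖(imagTimeWeight β M₁ : ℂ) * (∑ t₁ : ImagTimeIdx M₁,
              sectorisedKernel L₁ M₁ β (trivialMultiplier L₁ M₁)
                  (klEffectiveAction L₁ M₁ β U μ (klFlowFrameU L₁ M₁ β U μ n) klE0 n - counterQuadratic L₁ M₁ β (klFlowFrameU L₁ M₁ β U μ n)) 2
                  (![((0, σ), 0), ((0, σ), 1)] : Fin 2 → SectorLeg 1) ![o₁, (t₁, o₁.2 + y)] *
                Complex.exp (((matsubaraFreq β M₁ (omega0 M₁) * (imagTime β M₁ o₁.1 - imagTime β M₁ t₁) : ℝ) : ℂ) * I)) -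
            (imagTimeWeight β M₂ : ℂ) * (∑ t₁ : ImagTimeIdx M₂,
              sectorisedKernel L₁ M₂ β (trivialMultiplier L₁ M₂)
                  (klEffectiveAction L₁ M₂ β U μ (klFlowFrameU L₁ M₂ β U μ n) klE0 n - counterQuadratic L₁ M₂ β (klFlowFrameU L₁ M₂ β U μ n)) 2
                  (![((0, σ), 0), ((0, σ), 1)] : Fin 2 → SectorLeg 1) ![o₂, (t₁, o₂.2 + y)] *
                Complex.exp (((matsubaraFreq β M₂ (omega0 M₂) * (imagTime β M₂ o₂.1 - imagTime β M₂ t₁) : ℝ) : ℂ) * I))‖ +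
          ‖(imagTimeWeight β M₁ : ℂ) * (∑ t₁ : ImagTimeIdx M₁,
              sectorisedKernel L₁ M₁ β (trivialMultiplier L₁ M₁)
                  (klEffectiveAction L₁ M₁ β U μ (klFlowFrameU L₁ M₁ β U μ n) klE0 n - counterQuadratic L₁ M₁ β (klFlowFrameU L₁ M₁ β U μ n)) 2
                  (![((0, σ), 0), ((0, σ), 1)] : Fin 2 → SectorLeg 1) ![o₁, (t₁, o₁.2 + -y)] *
                Complex.exp (((matsubaraFreq β M₁ (omega0 M₁) * (imagTime β M₁ o₁.1 - imagTime β M₁ t₁) : ℝ) : ℂ) * I)) -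
            (imagTimeWeight β M₂ : ℂ) * (∑ t₁ : ImagTimeIdx M₂,
              sectorisedKernel L₁ M₂ β (trivialMultiplier L₁ M₂)
                  (klEffectiveAction L₁ M₂ β U μ (klFlowFrameU L₁ M₂ β U μ n) klE0 n - counterQuadratic L₁ M₂ β (klFlowFrameU L₁ M₂ β U μ n)) 2
                  (![((0, σ), 0), ((0, σ), 1)] : Fin 2 → SectorLeg 1) ![o₂, (t₁, o₂.2 + -y)] *
                Complex.exp (((matsubaraFreq β M₂ (omega0 M₂) * (imagTime β M₂ o₂.1 - imagTime β M₂ t₁) : ℝ) : ℂ) * I))‖) ≤ Dc n / L₁) ∧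
        (∀ σ : Fin 2, ∑ y : TorusSite 2 L₁,
          (‖(imagTimeWeight β M₁ : ℂ) * (∑ t₁ : ImagTimeIdx M₁,
              sectorisedKernel L₁ M₁ β (trivialMultiplier L₁ M₁)
                  (klEffectiveAction L₁ M₁ β U μ (klFlowFrameU L₁ M₁ β U μ n) klE0 n - counterQuadratic L₁ M₁ β (klFlowFrameU L₁ M₁ β U μ n)) 2
                  (![((0, σ), 0), ((0, σ), 1)] : Fin 2 → SectorLeg 1) ![o₁, (t₁, o₁.2 + y)] *
                Complex.exp (((matsubaraFreq β M₁ (omega0 M₁).rev * (imagTime β M₁ o₁.1 - imagTime β M₁ t₁) : ℝ) : ℂ) * I)) -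
            (imagTimeWeight β M₂ : ℂ) * (∑ t₁ : ImagTimeIdx M₂,
              sectorisedKernel L₁ M₂ β (trivialMultiplier L₁ M₂)
                  (klEffectiveAction L₁ M₂ β U μ (klFlowFrameU L₁ M₂ β U μ n) klE0 n - counterQuadratic L₁ M₂ β (klFlowFrameU L₁ M₂ β U μ n)) 2
                  (![((0, σ), 0), ((0, σ), 1)] : Fin 2 → SectorLeg 1) ![o₂, (t₁, o₂.2 + y)] *
                Complex.exp (((matsubaraFreq β M₂ (omega0 M₂).rev * (imagTime β M₂ o₂.1 - imagTime β M₂ t₁) : ℝ) : ℂ) * I))‖ +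
          ‖(imagTimeWeight β M₁ : ℂ) * (∑ t₁ : ImagTimeIdx M₁,
              sectorisedKernel L₁ M₁ β (trivialMultiplier L₁ M₁)
                  (klEffectiveAction L₁ M₁ β U μ (klFlowFrameU L₁ M₁ β U μ n) klE0 n - counterQuadratic L₁ M₁ β (klFlowFrameU L₁ M₁ β U μ n)) 2
                  (![((0, σ), 0), ((0, σ), 1)] : Fin 2 → SectorLeg 1) ![o₁, (t₁, o₁.2 + -y)] *
                Complex.exp (((matsubaraFreq β M₁ (omega0 M₁).rev * (imagTime β M₁ o₁.1 - imagTime β M₁ t₁) : ℝ) : ℂ) * I)) -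
            (imagTimeWeight β M₂ : ℂ) * (∑ t₁ : ImagTimeIdx M₂,
              sectorisedKernel L₁ M₂ β (trivialMultiplier L₁ M₂)
                  (klEffectiveAction L₁ M₂ β U μ (klFlowFrameU L₁ M₂ β U μ n) klE0 n - counterQuadratic L₁ M₂ β (klFlowFrameU L₁ M₂ β U μ n)) 2
                  (![((0, σ), 0), ((0, σ), 1)] : Fin 2 → SectorLeg 1) ![o₂, (t₁, o₂.2 + -y)] *
                Complex.exp (((matsubaraFreq β M₂ (omega0 M₂).rev * (imagTime β M₂ o₂.1 - imagTime β M₂ t₁) : ℝ) : ℂ) * I))‖) ≤ Dc n / L₁)) :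
    ∀ n ≤ N, ∀ (Mq : ℕ → ℕ) (L₁ M₁ M₂ : ℕ) [NeZero L₁] [NeZero M₁] [NeZero M₂], L ≤ L₁ → Q.M0 β L₁ ≤ M₁ → Mq L₁ ≤ M₁ → M₁ ≤ M₂ →
      (∀ j < n, histV17F2 L₁ M₁ G P Q R β U μ j ∧ TwoLegSlopes L₁ M₁ R β U μ (klFlowFrameU L₁ M₁ β U μ j) j) →
      (∀ j < n, histV17F2 L₁ M₂ G P Q R β U μ j ∧ TwoLegSlopes L₁ M₂ R β U μ (klFlowFrameU L₁ M₂ β U μ j) j) →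
        ∀ θ : ℝ, |klLocalPart L₁ M₁ β U μ (klFlowFrameU L₁ M₁ β U μ n) n θ -
          klLocalPart L₁ M₂ β U μ (klFlowFrameU L₁ M₂ β U μ n) n θ| ≤ Q.CL β n / 4 / L₁ := by
  have hDpos : 0 < klCurveD := by unfold klCurveD; linarith [cDtmin_window_ge]
  refine cutLeg_allScales_of_gridMoments_V17F2_rates (G := G) (P := P) (a := fun m => d * (4 : ℝ) ^ m) (Dc := Dc) (Zt := Zt) (Zs := Zs)
    hR hc hcle hU hUle hβmin hβc hμ hL h0 hN (fun n hn => ?_) hZs0 hGs hdual (fun n hn => ?_)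
  · calc d * (4 : ℝ) ^ n ≤ Q.CL β 0 / 4 * (4 : ℝ) ^ n := mul_le_mul_of_nonneg_right hdCL (by positivity)
      _ = Q.CL β 0 * (4 : ℝ) ^ n / 4 := by ring
      _ ≤ Q.CL β n / 4 := div_le_div_of_nonneg_right (hCL n hn) (by norm_num)
  · rw [sum_range_mul_four_pow]
    have hF0 : 0 ≤ d * ((4 : ℝ) ^ n - 1) / 3 := by
      have : (1 : ℝ) ≤ (4 : ℝ) ^ n := one_le_pow₀ (by norm_num)
      have : 0 ≤ d * ((4 : ℝ) ^ n - 1) := mul_nonneg hd (by linarith)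
      linarith
    have h1 : (Zs * U ^ 2 + 4 / 3 * R.Gfr 1 * U ^ 2) * (d * ((4 : ℝ) ^ n - 1) / 3) / klCurveD ≤ d * ((4 : ℝ) ^ n - 1) / 3 := by
      rw [div_le_iff₀ hDpos]
      calc (Zs * U ^ 2 + 4 / 3 * R.Gfr 1 * U ^ 2) * (d * ((4 : ℝ) ^ n - 1) / 3)
          ≤ klCurveD * (d * ((4 : ℝ) ^ n - 1) / 3) := mul_le_mul_of_nonneg_right hsmall hF0
        _ = d * ((4 : ℝ) ^ n - 1) / 3 * klCurveD := by ring
    have h2 := hDc n hn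
    have h3 : d * ((4 : ℝ) ^ n - 1) / 3 + (d * ((4 : ℝ) ^ n - 1) / 3 + Dc n) ≤ d * (4 : ℝ) ^ n := by nlinarith
    linarith

end V17F2

end Summit.HubbardSuperconductivity.HubbardSuperconductivity.Theorems.EngineV8

end
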